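import Summits.PneNP.PneNP.Theses.RamseyThreshold

/-!
# Route RamseyThreshold — typed decomposition of the deciding crux `RandomRamseyHypothesis` (stmt-PneNP-2050)

The SOS PINCER (crux-strategist, BC2 redirect): `RandomRamseyHypothesis` (X: no sound polynomial-time K₄-arrowing
certifier accepts `G(n, n^{δ-2/5})` with probability `≥ 1/2`, `0 < δ < 1/15`) follows from two typed pieces,

* X₁ = `SosBlindAboveThreshold` (crux stmt-PneNP-2051): for `0 < δ < 1/15` some `c > 0` has
  `Pr[degree-⌊n^c⌋ SOS fails to refute the non-arrowing CNF of G(n, n^{δ-2/5})] → 1` — an unconditional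
  proof-complexity lower bound (Kothari–Mori–O'Donnell–Witmer engine on the merged K₄-factor graph);
* X₂ = "polynomial-degree SOS CAPTURES every sound polynomial-time certifier" (new crux `SosCapturesCertifiers`,
  filed as route item stmt-PneNP-17626): for `0 < δ < 1/15`, EVERY `c > 0` and every sound poly-time `f`,
  `Pr[f accepts G ∧ degree-⌊n^c⌋ SOS fails to refute the non-arrowing CNF of G] → 0` — the SOS-optimality
  hypothesis of Barak–Kindler–Steurer / KMOW for this graph-induced ensemble (the wall, in SOS language);

by the pincer `1/2 ≤ Pr[acc] ≤ Pr[acc ∧ SOS fails] + (1 - Pr[SOS fails]) → 0 + 0`.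
The seam is the event-level upper/lower-bound pincer of average-case refutation (lower bound for a proof system +
capture of P by that proof system), not a propositional cut: neither piece implies X or `PneNP` by
`exact? | simpa | aesop` (probes recorded by the strategist), X₁ is attackable unconditionally, X₂ isolates exactly
what is P≠NP-hard.
-/

set_option linter.dupNamespace false -- `Summit.PneNP.PneNP.…`: summit = sub-problem name (D-0017 single-conjunct layout)

namespace Summit.PneNP.PneNP.Theorems

open scoped Classical
open Filter Summit.PneNP.PneNP.Theses.RamseyThreshold

/-- Complements for a `PMF`: `Pr[Sᶜ] = 1 - Pr[S]` in `ℝ≥0∞`. [folklore] -/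
theorem ramseyThreshold_pmf_toOuterMeasure_compl {α : Type*} (p : PMF α) (S : Set α) :
    p.toOuterMeasure Sᶜ = 1 - p.toOuterMeasure S := by
  have h : p.toOuterMeasure S + p.toOuterMeasure Sᶜ = 1 := by
    rw [PMF.toOuterMeasure_apply, PMF.toOuterMeasure_apply, ← ENNReal.tsum_add, ← p.tsum_coe]
    exact tsum_congr fun x => Set.indicator_self_add_compl_apply S p x
  have hS : p.toOuterMeasure S ≠ ⊤ := ne_top_of_le_ne_top ENNReal.one_ne_top (h ▸ le_self_add)
  exact ENNReal.eq_sub_of_add_eq hS (by rwa [add_comm] at h)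

/-- The pincer inequality `Pr[A] ≤ Pr[A ∩ B] + (1 - Pr[B])` for a `PMF`. [folklore] -/
theorem ramseyThreshold_pmf_pincer {α : Type*} (p : PMF α) (A B : Set α) :
    p.toOuterMeasure A ≤ p.toOuterMeasure (A ∩ B) + (1 - p.toOuterMeasure B) := by
  rw [← ramseyThreshold_pmf_toOuterMeasure_compl]
  calc p.toOuterMeasure A ≤ p.toOuterMeasure ((A ∩ B) ∪ Bᶜ) := by
        refine MeasureTheory.OuterMeasure.mono _ ?_
        intro x hx
        by_cases hB : x ∈ B
        · exact Or.inl ⟨hx, hB⟩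
        · exact Or.inr hB
    _ ≤ p.toOuterMeasure (A ∩ B) + p.toOuterMeasure Bᶜ := MeasureTheory.measure_union_le _ _

/-- Filter bookkeeping of the pincer: `Pr[Bₙ] → 1`, `Pr[Aₙ ∩ Bₙ] → 0` and
`Pr[Aₙ] ≤ Pr[Aₙ ∩ Bₙ] + (1 - Pr[Bₙ])` are incompatible with `Pr[Aₙ] ≥ 1/2` eventually. [folklore] -/
theorem ramseyThreshold_pincer_contra {μA μAB μB : ℕ → ENNReal}
    (hB : Tendsto μB atTop (nhds 1)) (hAB : Tendsto μAB atTop (nhds 0))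
    (hacc : ∀ᶠ n in atTop, (1 / 2 : ENNReal) ≤ μA n)
    (hle : ∀ n, μA n ≤ μAB n + (1 - μB n)) : False := by
  have hsub : Tendsto (fun n => 1 - μB n) atTop (nhds (1 - 1)) :=
    ENNReal.Tendsto.sub tendsto_const_nhds hB (Or.inl ENNReal.one_ne_top)
  rw [tsub_self] at hsub
  have hsum : Tendsto (fun n => μAB n + (1 - μB n)) atTop (nhds (0 + 0)) := hAB.add hsub
  rw [add_zero] at hsum
  have hhalf : (0 : ENNReal) < 1 / 2 := ENNReal.half_pos one_ne_zero
  obtain ⟨n, h1, h2⟩ := (hacc.and (hsum.eventually (gt_mem_nhds hhalf))).exists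
  exact absurd (lt_of_le_of_lt (h1.trans (hle n)) h2) (lt_irrefl _)

/-- **SOS pincer** — proof of the route's glue item `RandomRamseyHypothesisOfSosPincer` (stmt-PneNP-17642):
`SosBlindAboveThreshold → SosCapturesCertifiers → RandomRamseyHypothesis`, the typed decomposition (BC2 redirect) of the
deciding crux stmt-PneNP-2050 into stmt-PneNP-2051 ∧ stmt-PneNP-17626.  Given a sound poly-time `f` accepting
`G(n, n^{δ-2/5})` with probability `≥ 1/2` eventually, X₁ gives `c > 0` with `Pr[SOS_{⌊n^c⌋} fails] → 1`, X₂ at that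
`c` gives `Pr[f acc ∧ SOS_{⌊n^c⌋} fails] → 0`, and the pincer estimate `Pr[acc] ≤ Pr[acc ∧ fails] + (1 - Pr[fails])`
contradicts `1/2 ≤ Pr[acc]`.  [cite: arXiv:1701.04521, Thm. 2, §1 p.10 ("SDP-based algorithms capture all
state-of-the-art polynomial-time refutation algorithms except for Gaussian elimination")] [cite: Feige2002, §1] -/
theorem randomRamseyHypothesisOfSosPincer_proof : RandomRamseyHypothesisOfSosPincer := by
  intro h₁ h₂ δ hδ hδ' hex
  obtain ⟨f, hf, hsound, hacc⟩ := hex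
  obtain ⟨c, hc, hblind⟩ := h₁ δ hδ hδ'
  have hcap := h₂ δ hδ hδ' c hc f hf hsound
  exact ramseyThreshold_pincer_contra hblind hcap hacc fun n => ramseyThreshold_pmf_pincer _ _ _

end Summit.PneNP.PneNP.Theorems
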